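/-
Copyright (c) 2026. All rights reserved.
Released under Apache 2.0 license as described in the file LICENSE.
Authors: abc-iut cell — seat abc-iut-f-097 (block F fact-proving wave, tranche 97).
-/
import Mathlib.Algebra.Order.Archimedean.Real.Hom
import Mathlib.FieldTheory.KummerPolynomial
import Mathlib.NumberTheory.Real.Irrational
import Mathlib.RingTheory.AdjoinRoot
import Literature.AnabelianGeometry.AbsoluteAnabelian.GaloisTheatersTrivialContext
import HarnessLib

/-!
# [AbsTopIII] Cor 5.2 (i), full faithfulness: `EAHomExtendsToTheaters R` (FACT-LIST F-0106) is a SCHEMA over the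
# context `R` — universal closure refuted, the constraint it imposes on `R` made explicit

S. Mochizuki, *Topics in absolute anabelian geometry III: global reconstruction algorithms* [MochizukiAbsTopIII2015],
Cor 5.2 (i) p. 119 (author's manuscript pagination, lit key `paper:url-5493eb38cbb7`): the functors
`EA⊚ → An⊚[Th⊚] → Th⊚ → EA⊚` are equivalences — in particular every morphism `φ_Π : Π₁ ↪ Π₂` of `EA⊚` is the
group part of a morphism `V⊚(Π₁) → V⊚(Π₂)` of the canonical global Galois-theaters (Def 5.1 (iii) pp. 115–116:
condition (b) asks, at archimedean `v₁ ↦ v₂`, for an isomorphism `φ_v : X_{v₁} ⥲ X_{v₂}` "compatible with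
`κ_{v₁}`, `κ_{v₂}`" through `k_NF(Π₁) ⥲ k_NF(Π₂)`).

PROOF-ONLY companion of `GaloisTheaters.lean` (abc-iut-L4-t3), abc-iut cell seat abc-iut-f-097.  The trunk file
types Cor 5.2 (i) as the named `Prop` fact `EAHomExtendsToTheaters R` over an ARBITRARY interface record
`R : GlobalAnabelianContext` (the "objects functorially constructed from `Π`" of Def 5.1 (ii) as free fields
`kNF`, `proVal`, `archSpace`, `δell`, `κell`, `mapProVal`, `mapKNF`; its docstring: "an assumption on `R`, true for
the context of Thm 1.9 / Cor 2.8").  FACT-LIST row **F-0106** (`fact-open`, class preparatory, kernel_closedness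
`parametrised`) is therefore a schema (R5).  Kernel objects recorded here:

* `GlobalAnabelianContext.exists_fieldIso_of_eaHomExtendsToTheaters` — WHAT THE FACT DEMANDS OF `R`: along every
  morphism `f` of `EA⊚` and at every archimedean `v` of `V⊚(Π₁)`, the transport `k_NF(f) : k_NF(Π₁) ⥲ k_NF(Π₂)` must
  EXTEND, along the inclusions `κ_{ell}`, to a bicontinuous isomorphism of fields `A_{X(Π₁,v)} ⥲ A_{X(Π₂,v')}` —
  a law the record `GlobalAnabelianContext` does not carry (cf. the interface observation I-L4-t3-1 of
  `GaloisTheatersTrivialContext.lean` on `R.mapKNF (𝟙 Π)`);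
* `GlobalAnabelianContext.exists_context_mapKNF_not_extendable` — a context VIOLATING that law: `Ob(EA⊚) := {Π = 1}`,
  `k_NF(Π) := ℚ(√2)` (as `AdjoinRoot (X² − 2)`), `k_NF(f) := (√2 ↦ −√2)` for every `f`, `V⊚(Π) := {⊚, v_∞}` with the
  trivial action, `A_{X(Π,v_∞)} := ℝ`, `κ := (√2 ↦ √2)`; since `ℝ` has no ring endomorphism but the identity
  (`Real.RingHom.unique`), `√2 ↦ −√2` does not extend;
* `not_forall_eaHomExtendsToTheaters` — **the universal closure of F-0106 is false**; together with the instance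
  form PROVED in tree (`eaHomExtendsToTheaters_of_subsingleton`, `GlobalAnabelianContext.exists_context_theaterFacts`:
  the fact HOLDS at the trivial-group context) this gives `eaHomExtendsToTheaters_independent`: F-0106 is a genuine,
  independent hypothesis on `R`, admissible only in instance form.

No cone consumer cites an instance of F-0106 (grep over `Literature/`, `Summits/`: `GaloisTheatersTrivialContext.lean`
and the registry line of `Summits/ABC/IUTFork/DAGL4s.lean` only).  HONEST FRAMING: Cor 5.2 (i) is a refereed
statement about the genuine context (étale `π₁` of hyperbolic orbicurves + Thm 1.9 / Cor 2.8–2.9, not in the tree —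
FOUNDATIONS row 12); what is refuted is only the closure of the cell's free-record typing, a statement about the
schema, not about the paper; the counterexample context is DEGENERATE (`Π = 1`).  Nothing here bears on the disputed
[IUTchIII] Cor. 3.12; typed ≠ proved; instantiated ≠ endorsed; no side taken.
-/

noncomputable section

namespace Literature.AnabelianGeometry.AbsoluteAnabelian

open CategoryTheory Topology Polynomial

universe u

/-! ### What `EAHomExtendsToTheaters R` demands of the record `R` -/

/-- **The constraint Cor 5.2 (i) (full faithfulness) imposes on a context.**  If `EAHomExtendsToTheaters R`, then for
every morphism `f : Π₁ → Π₂` of `EA⊚` and every archimedean element `v` of `V⊚(Π₁)` there are an archimedean `v'` of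
`V⊚(Π₂)` and a bicontinuous isomorphism of fields `ρ : A_{X(Π₁,v)} ⥲ A_{X(Π₂,v')}` EXTENDING the transport `k_NF(f)`
along `κ_{ell,v}`, `κ_{ell,v'}` (namely `v' = φ_V(v)` and `ρ =` the field part of the `φ_v` of Def 5.1 (iii) (b)).
[cite: MochizukiAbsTopIII2015, Cor 5.2 (i) p. 119] -/
theorem GlobalAnabelianContext.exists_fieldIso_of_eaHomExtendsToTheaters (R : GlobalAnabelianContext.{u})
    (h : EAHomExtendsToTheaters R) {E₁ E₂ : FundamentalExtension.{u}} (h₁ : R.IsAdmissible E₁)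
    (h₂ : R.IsAdmissible E₂) (f : E₁ ⟶ E₂) (hf : IsEAHom f) (v : (R.proVal E₁).arc) :
    ∃ (v' : (R.proVal E₂).arc) (ρ : (R.archSpace E₁ v).fieldA ≃+* (R.archSpace E₂ v').fieldA),
      IsHomeomorph ρ ∧ ∀ x : R.kNF E₁, R.κell E₂ v' (R.mapKNF f hf x) = ρ (R.κell E₁ v x) := by
  obtain ⟨φ, hφ⟩ := h E₁ E₂ h₁ h₂ f hf
  subst hφ
  have hva : φ.φV v ∈ (R.proVal E₂).arc := φ.image_arc ▸ Set.mem_image_of_mem _ v.2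
  obtain ⟨φv, hh, -, hκ⟩ := φ.arch_compat v hva
  exact ⟨⟨φ.φV v, hva⟩, φv.fieldIso, hh, fun x => hκ x⟩

/-! ### A context whose `k_NF`-transport does not extend along `κ` -/

/-- `2` is not the square of a rational number (from `irrational_sqrt_two`). [folklore] -/
private theorem rat_sq_ne_two (b : ℚ) : b ^ 2 ≠ 2 := by
  intro hb
  have h2 : ((b : ℝ)) ^ 2 = 2 := by exact_mod_cast hb
  have hs : (√2 : ℝ) = ((|b| : ℚ) : ℝ) := by rw [Rat.cast_abs, ← Real.sqrt_sq_eq_abs, h2]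
  exact irrational_sqrt_two.ne_rat |b| hs

/-- **A context violating the extension law.**  There is a context `R` (`Ob(EA⊚) := {Π ↠ G : Π = 1}` — for such `Π`
the subgroup `Δ = 1` IS the maximal topologically finitely generated closed normal subgroup; `k_NF(Π) := ℚ(√2)` with
the trivial action; `k_NF(f) := (√2 ↦ −√2)` for EVERY `f`; `V⊚(Π) := {⊚, v_∞}`, `v_∞` archimedean, trivial action,
`V⊚(f) := id`; `X(Π, v_∞) :=` a point with `A_X := ℝ` and `π₁^∧ := Δ`, `δ := id`, `κ := (√2 ↦ √2)`), an admissible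
`Π` (the point `1 ↠ 1`) and an archimedean `v` such that for NO endomorphism `f` of `Π` in `EA⊚`, NO archimedean `v'`
and NO field isomorphism `ρ : A_{X(Π,v)} ⥲ A_{X(Π,v')}` does `ρ ∘ κ_v = κ_{v'} ∘ k_NF(f)` hold (`ℝ` is rigid:
`Real.RingHom.unique`).  DEGENERATE, a statement about the record `GlobalAnabelianContext`, not about curves.
[cite: MochizukiAbsTopIII2015, Def 5.1 (iii) p. 115] -/
theorem GlobalAnabelianContext.exists_context_mapKNF_not_extendable :
    ∃ (R : GlobalAnabelianContext.{0}) (E : FundamentalExtension.{0}) (_ : R.IsAdmissible E)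
      (v : (R.proVal E).arc),
      ∀ (f : E ⟶ E) (hf : IsEAHom f) (v' : (R.proVal E).arc)
        (ρ : (R.archSpace E v).fieldA ≃+* (R.archSpace E v').fieldA),
        ∃ x : R.kNF E, R.κell E v' (R.mapKNF f hf x) ≠ ρ (R.κell E v x) := by
  -- the field `K = ℚ(√2) := AdjoinRoot (X² - 2)`, its automorphism `τ : √2 ↦ -√2`, its real embedding `κ₀`
  let p : ℚ[X] := X ^ 2 - C 2
  haveI : Fact (Irreducible p) := ⟨X_pow_sub_C_irreducible_of_prime Nat.prime_two rat_sq_ne_two⟩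
  have hp0 : AdjoinRoot.root p ^ 2 - AdjoinRoot.of p 2 = 0 := by
    have h := AdjoinRoot.eval₂_root p
    change eval₂ (AdjoinRoot.of p) (AdjoinRoot.root p) (X ^ 2 - C 2) = 0 at h
    rwa [eval₂_sub, eval₂_X_pow, eval₂_C] at h
  have hneg : p.eval₂ (AdjoinRoot.of p) (-AdjoinRoot.root p) = 0 := by
    change eval₂ (AdjoinRoot.of p) (-AdjoinRoot.root p) (X ^ 2 - C 2) = 0
    rw [eval₂_sub, eval₂_X_pow, eval₂_C, neg_sq]
    exact hp0
  let σ : AdjoinRoot p →+* AdjoinRoot p := AdjoinRoot.lift (AdjoinRoot.of p) (-AdjoinRoot.root p) hneg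
  have hσ : σ (AdjoinRoot.root p) = -AdjoinRoot.root p := AdjoinRoot.lift_root hneg
  have hσof : ∀ a : ℚ, σ (AdjoinRoot.of p a) = AdjoinRoot.of p a := fun a => AdjoinRoot.lift_of hneg
  have hσσ : σ.comp σ = RingHom.id (AdjoinRoot p) := by
    refine Ideal.Quotient.ringHom_ext (Polynomial.ringHom_ext (fun a => ?_) ?_)
    · change σ (σ (AdjoinRoot.of p a)) = AdjoinRoot.of p a
      rw [hσof, hσof]
    · change σ (σ (AdjoinRoot.root p)) = AdjoinRoot.root p
      rw [hσ, map_neg, hσ, neg_neg]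
  let τ : AdjoinRoot p ≃+* AdjoinRoot p :=
    { toFun := σ
      invFun := σ
      left_inv := fun x => RingHom.congr_fun hσσ x
      right_inv := fun x => RingHom.congr_fun hσσ x
      map_mul' := map_mul σ
      map_add' := map_add σ }
  have hκ : p.eval₂ (algebraMap ℚ ℝ) (√2) = 0 := by
    change eval₂ (algebraMap ℚ ℝ) (√2) (X ^ 2 - C 2) = 0
    rw [eval₂_sub, eval₂_X_pow, eval₂_C, map_ofNat, Real.sq_sqrt zero_le_two, sub_self]
  let κ₀ : AdjoinRoot p →+* ℝ := AdjoinRoot.lift (algebraMap ℚ ℝ) (√2) hκ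
  have hκroot : κ₀ (AdjoinRoot.root p) = √2 := AdjoinRoot.lift_root hκ
  -- the pro-sets `{⊚, v_∞}` (trivial action, `v_∞` archimedean)
  let V : ∀ E : FundamentalExtension.{0}, GaloisProSet E.arith := fun E =>
    letI : MulAction E.arith Bool := MulAction.compHom Bool (1 : E.arith →* Function.End Bool)
    { carrier := Bool
      continuousSMul := ⟨by exact continuous_snd⟩
      generic := false
      non := ∅
      arc := {true}
      smul_generic := fun _ => rfl
      generic_notMem_non := fun h => h
      generic_notMem_arc := fun h => Bool.false_ne_true (Set.mem_singleton_iff.mp h)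
      disjoint_non_arc := disjoint_bot_left
      eq_generic_or_mem := fun v => by
        cases v
        · exact Or.inl rfl
        · exact Or.inr (Or.inr (Set.mem_singleton _))
      smul_mem_non := fun _ _ h => h
      smul_mem_arc := fun _ _ h => h }
  -- `Ob(EA⊚) := {Π = 1}` (transported along isomorphisms; `Δ = Π = 1` is the maximal tfg closed normal subgroup)
  have hiso : ∀ {E₁ E₂ : FundamentalExtension.{0}}, Nonempty (E₁ ≅ E₂) →
      Subsingleton E₁.arith → Subsingleton E₂.arith := by
    rintro E₁ E₂ ⟨e⟩ h
    refine ⟨fun a b => ?_⟩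
    have ha : (e.inv ≫ e.hom).arith a = a := by rw [e.inv_hom_id]; rfl
    have hb : (e.inv ≫ e.hom).arith b = b := by rw [e.inv_hom_id]; rfl
    rw [← ha, ← hb, FundamentalExtension.comp_arith]
    exact congrArg e.hom.arith (Subsingleton.elim _ _)
  have hmax : ∀ E : FundamentalExtension.{0}, Subsingleton E.arith → IsMaxTopFGClosedNormal E.geom := by
    intro E hE
    exact
      { normal := inferInstanceAs E.aug.toMonoidHom.ker.Normal
        isClosed := E.isClosed_geom
        topFG := ⟨∅, eq_top_iff.mpr fun x _ => by rw [Subsingleton.elim x 1]; exact one_mem _⟩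
        maximal := fun N _ _ _ x _ => by rw [Subsingleton.elim x 1]; exact one_mem _ }
  let R : GlobalAnabelianContext.{0} :=
    { IsAdmissible := fun E => Subsingleton E.arith
      isAdmissible_of_iso := hiso
      geom_isMax := hmax
      kNF := fun _ => AdjoinRoot p
      instField := fun _ => inferInstance
      instAction := fun E =>
        MulSemiringAction.compHom _ (1 : E.arith →* (AdjoinRoot p →+* AdjoinRoot p))
      proVal := V
      archSpace := fun E _ => { carrier := PUnit, fieldA := ℝ, pi1Hat := E.geomGrp }
      δell := fun E _ => ContinuousMulEquiv.refl _
      κell := fun _ _ => κ₀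
      mapProVal := fun _ _ => Homeomorph.refl _
      mapProVal_smul := fun _ _ _ _ => rfl
      mapKNF := fun _ _ => τ }
  -- the point extension `Π = G = 1`
  let E₀ : FundamentalExtension.{0} :=
    { arith := ProfiniteGrp.of PUnit.{1}, gal := ProfiniteGrp.of PUnit.{1},
      aug := ContinuousMonoidHom.id _, aug_surjective := Function.surjective_id }
  have hE₀ : R.IsAdmissible E₀ := inferInstanceAs (Subsingleton PUnit)
  refine ⟨R, E₀, hE₀, ⟨true, Set.mem_singleton _⟩, fun f hf v' ρ => ⟨AdjoinRoot.root p, ?_⟩⟩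
  -- `ρ : ℝ ≃+* ℝ` is the identity, `k_NF(f) = τ` sends `√2 ↦ -√2`
  change κ₀ (σ (AdjoinRoot.root p)) ≠ (ρ : ℝ ≃+* ℝ) (κ₀ (AdjoinRoot.root p))
  have hρ : ((ρ : ℝ ≃+* ℝ) : ℝ →+* ℝ) = RingHom.id ℝ := Subsingleton.elim _ _
  rw [hσ, map_neg, hκroot, ← RingEquiv.coe_toRingHom, hρ, RingHom.id_apply]
  have h2 : (0 : ℝ) < √2 := Real.sqrt_pos.mpr two_pos
  linarith

/-! ### The universal closure of F-0106 is false -/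

/-- **The universal closure of F-0106 is false**: `EAHomExtendsToTheaters R` fails at the context of
`exists_context_mapKNF_not_extendable` (take `f := 𝟙 Π` at the point and the archimedean `v_∞`: by
`exists_fieldIso_of_eaHomExtendsToTheaters` the transport `√2 ↦ −√2` would extend along `κ` to a ring automorphism
of `ℝ`, i.e. to the identity).  Cor 5.2 (i) itself (the genuine context) is not touched.
[cite: MochizukiAbsTopIII2015, Cor 5.2 (i) p. 119] -/
theorem not_forall_eaHomExtendsToTheaters : ¬ ∀ R : GlobalAnabelianContext.{0}, EAHomExtendsToTheaters R := by
  intro H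
  obtain ⟨R, E, hE, v, hv⟩ := GlobalAnabelianContext.exists_context_mapKNF_not_extendable
  obtain ⟨v', ρ, -, hρ⟩ :=
    R.exists_fieldIso_of_eaHomExtendsToTheaters (H R) hE hE (𝟙 E) (isEAHom_id E) v
  obtain ⟨x, hx⟩ := hv (𝟙 E) (isEAHom_id E) v' ρ
  exact hx (hρ x)

/-- **F-0106 is an independent hypothesis on the context**: it HOLDS at some context (the trivial-group context of
`GaloisTheatersTrivialContext.lean`, via `eaHomExtendsToTheaters_of_subsingleton`) and FAILS at another
(`exists_context_mapKNF_not_extendable`); it is admissible only in instance form (R5).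
[cite: MochizukiAbsTopIII2015, Cor 5.2 (i) p. 119] -/
theorem eaHomExtendsToTheaters_independent :
    (∃ R : GlobalAnabelianContext.{0}, EAHomExtendsToTheaters R) ∧
      ∃ R : GlobalAnabelianContext.{0}, ¬ EAHomExtendsToTheaters R := by
  refine ⟨?_, not_forall.mp not_forall_eaHomExtendsToTheaters⟩
  obtain ⟨R, -, -, -, -, -, -, -, -, h, -⟩ := GlobalAnabelianContext.exists_context_theaterFacts.{0}
  exact ⟨R, h⟩

end Literature.AnabelianGeometry.AbsoluteAnabelian

end
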